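import Mathlib
import HarnessLib
import Literature.Analysis.FluidPDE.SuitableWeak
import Literature.Analysis.FluidPDE.SelfSimilar
import Literature.Analysis.FluidPDE.LocalTypeI
import Summits.NavierStokesRegularity.NavierStokesRegularity.Theorems.RellichScarApexLocalisationRussianDoll
import Summits.NavierStokesRegularity.NavierStokesRegularity.Theses.RellichScar

/-!
# `RellichScar.ApexLocalisation` ⇔ weak-`L³` selection (line russian-doll-multiplicity, lead c5:
# the line's normal form, certified)

With the Russian-doll theorem `stub_rdWeakL3Localisation` LANDED (weak-`L³` Type-I profiles localise),
the crux `Summit.NavierStokesRegularity.NavierStokesRegularity.Theses.RellichScar.ApexLocalisation`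
(stmt-NavierStokesRegularity-11719) is EQUIVALENT to the line's registered bet `stub_weakL3Selection`:

  `ApexLocalisation ↔ ∀ C, (rate-Type-I singular slab profile with constant C and 𝐈 < ⊤ exists) →`
  `  ∃ C₁ M and a rate-Type-I singular slab profile with 𝐈 < ⊤ whose slices are uniformly weak-L³:`
  `  h³ |{x : h < ‖u(t,x)‖}| ≤ M for all t < 0, h > 0`

(`⇐`: the doll theorem; `⇒`: an apex profile `‖u‖ ≤ C'/(‖x‖ + √(−t))` has its slice superlevel sets
inside the balls `B(0, C'/h)`, so `h³ |{‖u(t)‖ > h}| ≤ C'³ |B₁|`, `rd_sliceBound_of_hasTypeIDecay`).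
So the crux reads: Type-I (rate + 𝐈) blow-up admits SOME blow-up profile of bounded lump multiplicity
(the `L^∞_t L^{3,∞}_x` class of Choe–Wolf–Yang 2019 / Barker 2022).

## References

* D. Albritton, T. Barker, J. Math. Fluid Mech. 21 (2019) = arXiv:1811.00502. [AlbrittonBarker2019]
* H. J. Choe, J. Wolf, M. Yang, Math. Ann. (2020) = arXiv:1611.04725, Thm 2. [ChoeWolfYang2019]
* T. Barker, arXiv:2111.14776, Thm 2. [Barker2024]
-/

noncomputable section

set_option linter.dupNamespace false

namespace Summit.NavierStokesRegularity.NavierStokesRegularity.Theorems.RellichScarApexLocalisation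

open MeasureTheory Set Function Metric Filter Topology TopologicalSpace
open scoped ENNReal NNReal
open Literature.Analysis Literature.Analysis.FluidPDE
open Summit.NavierStokesRegularity.NavierStokesRegularity.Theses

local notation "E³" => EuclideanSpace ℝ (Fin 3)

/-- The open backward slab `(-∞, 0) × ℝ³` (time first). -/
local notation "𝕊" => Literature.Analysis.FluidPDE.slab (EuclideanSpace ℝ (Fin 3)) (Set.Iio (0 : ℝ)) isOpen_Iio

/-- **Apex ⇒ weak-`L³` slices.** The space–time Type-I bound `‖u(t,x)‖ ≤ C'/(‖x‖ + √(−t))` puts the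
superlevel set `{x : h < ‖u(t,x)‖}` inside the ball `B(0, C'/h)`, so `h³ |{x : h < ‖u(t,x)‖}| ≤ C'³ |B(0,1)|`
for every `t < 0`, `h > 0`. [folklore] -/
theorem rd_sliceBound_of_hasTypeIDecay {C' : ℝ} {u : ℝ → E³ → E³} (hdec : HasTypeIDecay C' u) :
    ∀ t : ℝ, t < 0 → ∀ h : ℝ, 0 < h →
      ENNReal.ofReal (h ^ 3) * volume {x : E³ | h < ‖u t x‖} ≤
        ENNReal.ofReal (max C' 0 ^ 3 * (volume (ball (0 : E³) 1)).toReal) := by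
  intro t ht h hh
  have hst : 0 < Real.sqrt (-t) := Real.sqrt_pos.2 (by linarith)
  -- the superlevel set lies in the ball of radius `max C' 0 / h`
  have hsub : {x : E³ | h < ‖u t x‖} ⊆ ball (0 : E³) (max C' 0 / h) := by
    intro x hx
    have hx' : h < ‖u t x‖ := hx
    have hden : 0 < ‖x‖ + Real.sqrt (-t) := by positivity
    have h1 : h < C' / (‖x‖ + Real.sqrt (-t)) := lt_of_lt_of_le hx' (hdec t ht x)
    rw [lt_div_iff₀ hden] at h1
    rw [mem_ball, dist_zero_right, lt_div_iff₀ hh]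
    nlinarith [le_max_left C' 0, mul_pos hh hst, norm_nonneg x]
  have hr : 0 ≤ max C' 0 / h := div_nonneg (le_max_right _ _) hh.le
  have hball : volume (ball (0 : E³) (max C' 0 / h)) =
      ENNReal.ofReal ((max C' 0 / h) ^ 3) * volume (ball (0 : E³) 1) := by
    rw [Measure.addHaar_ball volume (0 : E³) hr, finrank_euclideanSpace_fin]
  have hfin : volume (ball (0 : E³) 1) ≠ ⊤ := measure_ball_lt_top.ne
  calc ENNReal.ofReal (h ^ 3) * volume {x : E³ | h < ‖u t x‖}
      ≤ ENNReal.ofReal (h ^ 3) * volume (ball (0 : E³) (max C' 0 / h)) := by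
        gcongr
    _ = ENNReal.ofReal (h ^ 3 * (max C' 0 / h) ^ 3) * volume (ball (0 : E³) 1) := by
        rw [hball, ← mul_assoc, ← ENNReal.ofReal_mul (by positivity)]
    _ = ENNReal.ofReal (max C' 0 ^ 3) * ENNReal.ofReal ((volume (ball (0 : E³) 1)).toReal) := by
        rw [ENNReal.ofReal_toReal hfin]
        congr 2
        field_simp
    _ = ENNReal.ofReal (max C' 0 ^ 3 * (volume (ball (0 : E³) 1)).toReal) := by
        rw [← ENNReal.ofReal_mul (by positivity)]

/-- **Crux ⇒ bet**: an apex-class singular profile is a rate-class singular profile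
(`HasTypeIDecay.hasTypeITimeDecay`, the constant being nonnegative at a singular profile) whose slices are
uniformly weak-`L³` (`rd_sliceBound_of_hasTypeIDecay`). [folklore] -/
theorem rd_weakL3Selection_of_apexLocalisation (h : RellichScar.ApexLocalisation) :
    ∀ C : ℝ,
      (∃ (u : ℝ → E³ → E³) (p : ℝ → E³ → ℝ) (G : ℝ → E³ → E³ →L[ℝ] E³),
        IsSuitableWeakSolutionOn 𝕊 1 0 u p ∧ HasWeakSpatialGradientOn 𝕊 u G ∧
        typeIBound (Iio (0 : ℝ) ×ˢ univ) u p G < ⊤ ∧ HasTypeITimeDecay C u ∧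
        IsBackwardSingularPoint u 0) →
      ∃ (C₁ M : ℝ) (u : ℝ → E³ → E³) (p : ℝ → E³ → ℝ) (G : ℝ → E³ → E³ →L[ℝ] E³),
        IsSuitableWeakSolutionOn 𝕊 1 0 u p ∧ HasWeakSpatialGradientOn 𝕊 u G ∧
        typeIBound (Iio (0 : ℝ) ×ˢ univ) u p G < ⊤ ∧ HasTypeITimeDecay C₁ u ∧
        IsBackwardSingularPoint u 0 ∧
        ∀ t : ℝ, t < 0 → ∀ h : ℝ, 0 < h →
          ENNReal.ofReal (h ^ 3) * volume {x : E³ | h < ‖u t x‖} ≤ ENNReal.ofReal M := by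
  intro C hC
  obtain ⟨C', u, p, G, hsw, hwg, hI, hdec, hsing⟩ := h C hC
  have hC'0 : 0 ≤ C' := by
    have h1 := hdec (-1) (by norm_num) 0
    rw [norm_zero, zero_add, neg_neg, Real.sqrt_one, div_one] at h1
    exact (norm_nonneg _).trans h1
  exact ⟨C', max C' 0 ^ 3 * (volume (ball (0 : E³) 1)).toReal, u, p, G, hsw, hwg, hI,
    hdec.hasTypeITimeDecay hC'0, hsing, rd_sliceBound_of_hasTypeIDecay hdec⟩

/-- **`RellichScar.ApexLocalisation` ⇔ WEAK-`L³` SELECTION** (registered certificate stub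
`stub_rdCruxIffWeakL3Selection` of crux stmt-NavierStokesRegularity-11719; the normal form of line
russian-doll-multiplicity): the crux holds iff every rate-Type-I singular slab profile class (constant `C`,
`𝐈 < ⊤`) being inhabited forces the existence of a rate-Type-I singular slab profile with `𝐈 < ⊤` and
uniformly weak-`L³` slices.  `⇒`: `rd_weakL3Selection_of_apexLocalisation`; `⇐`: the Russian-doll
theorem `stub_rdWeakL3Localisation`. [cite: AlbrittonBarker2019, Lemma 2.2, Prop. 2.3 and §3] -/
theorem stub_rdCruxIffWeakL3Selection :
    RellichScar.ApexLocalisation ↔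
    (∀ C : ℝ,
        (∃ (u : ℝ → E³ → E³) (p : ℝ → E³ → ℝ) (G : ℝ → E³ → E³ →L[ℝ] E³),
          IsSuitableWeakSolutionOn 𝕊 1 0 u p ∧ HasWeakSpatialGradientOn 𝕊 u G ∧
          typeIBound (Iio (0 : ℝ) ×ˢ univ) u p G < ⊤ ∧ HasTypeITimeDecay C u ∧
          IsBackwardSingularPoint u 0) →
        ∃ (C₁ M : ℝ) (u : ℝ → E³ → E³) (p : ℝ → E³ → ℝ) (G : ℝ → E³ → E³ →L[ℝ] E³),
          IsSuitableWeakSolutionOn 𝕊 1 0 u p ∧ HasWeakSpatialGradientOn 𝕊 u G ∧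
          typeIBound (Iio (0 : ℝ) ×ˢ univ) u p G < ⊤ ∧ HasTypeITimeDecay C₁ u ∧
          IsBackwardSingularPoint u 0 ∧
          ∀ t : ℝ, t < 0 → ∀ h : ℝ, 0 < h →
            ENNReal.ofReal (h ^ 3) * volume {x : E³ | h < ‖u t x‖} ≤ ENNReal.ofReal M) := by
  refine ⟨rd_weakL3Selection_of_apexLocalisation, fun hS C hC => ?_⟩
  obtain ⟨C₁, M, u, p, G, hsw, hwg, hI, hrate, hsing, hweak⟩ := hS C hC
  exact stub_rdWeakL3Localisation C₁ M ⟨u, p, G, hsw, hwg, hI, hrate, hsing, hweak⟩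

end Summit.NavierStokesRegularity.NavierStokesRegularity.Theorems.RellichScarApexLocalisation

end
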